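import Mathlib
import HarnessLib
import Summits.Ventures.LatticeQCDFlow.Exactness.SphereFlowRelativeEntropy
import Summits.Ventures.LatticeQCDFlow.Exactness.LatticeBoundedDifferences

/-!
# The volume law of exact flow samplers on the lattice of spheres: if the effective action `S_eff = t·S∘Φ_{s→c} − ℓ_{s→c}` has bounded differences `D_k`, then `Var_π̄(S_eff) ≤ ΣD_k²/4`, `KL((Φ_{s→c})_*π̄ ‖ π̄.tilted(−tS)) ≤ ΣD_k²/8` and `ESS ≥ exp(−ΣD_k²/2)` — every jointly `C³` generator

HONEST FRAMING: exact (Metropolis-corrected) sampling algorithms for lattice gauge theory;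
figures of merit are autocorrelation/cost numbers at stated couplings and volumes; no
continuum-physics claim.

Venture `LatticeQCDFlow` (cell pub-lqcd), topic `Exactness`; FANOUT row 7 (`s0-cpn-null`: the
S0-D1 rung — 2D CP⁹, Lüscher's LO trivializing map inside HMC, Engel–Schaefer 2011).  NEW WORK of
the cell over this leg's `Exactness/LatticeBoundedDifferences.lean` (McDiarmid's exponential-moment
bound and the Efron–Stein–Popoviciu variance bound for continuous bounded-difference functionals of
the product law) and GEN-15's `Exactness/SphereFlowRelativeEntropy.lean` /
`Exactness/SphereFlowResidualAction.lean` (`KL = E_π̄[S_eff] + log Z_t`; exact reweighting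
`∫e^{−S_eff} H∘Φ dπ̄ = ∫e^{−tS}H dπ̄` for EVERY jointly `C³` generator); nothing is cited as a fact.
Printed counterpart, NAMED ONLY: the reweighting / effective-sample-size bookkeeping of flow-based
samplers (Albergo–Kanwar–Shanahan, Phys. Rev. D 100 (2019) 034515, §II; Nicoli et al., Phys. Rev.
E 101 (2020) 023304); C. McDiarmid 1989 Lemma (1.2).  THIS FILE isolates the PRINCIPLE behind the
leg's LO volume laws (`SphereLOFlowEffectiveActionConcentration`): for any exact flow sampler on the
lattice of spheres, the reweighting cost in nats is at most half the sum of the squared bounded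
differences of its effective action — so a flow whose effective action has per-site differences
`O(δ)` uniformly in the volume costs `O(δ²·|Λ|)`.

## Setting

`π̄ = ⊗_Λ σ̄` on `Ω = S(E)^Λ`; `G : ℝ → (Λ → E) → ℝ` jointly `C³`, horizon `T`, `|s|, |c| ≤ |T| + 1`;
`S ∈ C¹`, real `t`; `Φ = Φ_{s→c} = sphereTDFlow hG T s c`, `ℓ = ℓ_{s→c} = sphereTDFlowLogJac hG T s c`;
THE EFFECTIVE ACTION `S_eff(ω) = t·S(Φω) − ℓ(ω)` (its law under `Φ` is the target `π̄.tilted(−tS)`,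
GEN-15 IV); `w = e^{−S_eff}` the importance weights of the uncorrected sampler; HYPOTHESIS:
`S_eff(ω[k←v]) − S_eff(ω[k←v']) ≤ D_k` on `Ω`.

## Content

* `continuous_effAction` — `S_eff` is continuous on `Ω`.
* **`variance_effAction_le_of_bddDiff`** — `Var_π̄(S_eff) ≤ ΣD_k²/4`.
* **`integral_exp_mul_effAction_sub_le_of_bddDiff`** — `∫e^{u(S_eff − E S_eff)}dπ̄ ≤ e^{u²ΣD_k²/8}`.
* **`toReal_klDiv_map_le_of_bddDiff`** — `KL((Φ_{s→c})_*π̄ ‖ π̄.tilted(−tS)) ≤ ΣD_k²/8`.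
* **`sq_integral_weight_ge_of_bddDiff`** — `exp(−ΣD_k²/2)·∫w² dπ̄ ≤ (∫w dπ̄)²`: THE EFFECTIVE SAMPLE
  SIZE OF ANY EXACT FLOW SAMPLER IS AT LEAST `exp(−ΣD_k²/2)` OF NOMINAL.

NOT CLAIMED: how to obtain bounded differences for a given generator (the leg does it for the E–S
leading-order flow: `D_k = (12κ²υ²/(d−1))c²e^{Kc}`); lower bounds; numbers.
-/

noncomputable section

namespace Summit.Ventures.LatticeQCDFlow.Exactness

open Function Set Metric MeasureTheory NormedSpace InnerProductSpace InformationTheory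
open scoped RealInnerProductSpace Topology

variable {Λ : Type*} {E : Type*} [NormedAddCommGroup E] [InnerProductSpace ℝ E]
  [FiniteDimensional ℝ E] [Fintype Λ] [DecidableEq Λ] [MeasurableSpace E] [BorelSpace E] [Nontrivial E]
  {G : ℝ → (Λ → E) → ℝ} {T : ℝ}

omit [MeasurableSpace E] [BorelSpace E] [Nontrivial E] in
/-- **`S_eff = t·S∘Φ_{s→c} − ℓ_{s→c}` is continuous on `Ω`** (jointly `C³` generator, `S ∈ C¹`). -/
theorem continuous_effAction (hG : ContDiff ℝ 2 fun q : ℝ × (Λ → E) => G q.1 q.2)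
    (hG3 : ContDiff ℝ 3 fun q : ℝ × (Λ → E) => G q.1 q.2) {S : (Λ → E) → ℝ} (hS : ContDiff ℝ 1 S)
    (t s c : ℝ) :
    Continuous fun ω : Λ → sphere (0 : E) 1 =>
      t * S (sphereTDFlow hG T s c (fun m => (ω m : E))) - sphereTDFlowLogJac hG T s c (fun m => (ω m : E)) :=
  (continuous_const.mul ((hS.continuous.comp (contDiff_sphereTDFlow_apply hG s c (T := T)).continuous).comp
    continuous_sphereConfig)).sub (continuous_sphereTDFlowLogJac_sphereConfig hG hG3 s c (T := T))

/-- **`Var_π̄(S_eff) ≤ ΣD_k²/4`** for every exact flow sampler whose effective action has bounded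
differences `D_k` (Efron–Stein–Popoviciu). -/
theorem variance_effAction_le_of_bddDiff (hG : ContDiff ℝ 2 fun q : ℝ × (Λ → E) => G q.1 q.2)
    (hG3 : ContDiff ℝ 3 fun q : ℝ × (Λ → E) => G q.1 q.2) {S : (Λ → E) → ℝ} (hS : ContDiff ℝ 1 S)
    (t s c : ℝ) {D : Λ → ℝ}
    (hD : ∀ (ω : Λ → sphere (0 : E) 1) (k : Λ) (v v' : sphere (0 : E) 1),
      (t * S (sphereTDFlow hG T s c (fun m => ((update ω k v) m : E))) -
          sphereTDFlowLogJac hG T s c (fun m => ((update ω k v) m : E))) -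
        (t * S (sphereTDFlow hG T s c (fun m => ((update ω k v') m : E))) -
          sphereTDFlowLogJac hG T s c (fun m => ((update ω k v') m : E))) ≤ D k) :
    ∫ ω, (t * S (sphereTDFlow hG T s c (fun m => ((ω : Λ → sphere (0 : E) 1) m : E))) -
          sphereTDFlowLogJac hG T s c (fun m => (ω m : E)) -
        ∫ ω', (t * S (sphereTDFlow hG T s c (fun m => ((ω' : Λ → sphere (0 : E) 1) m : E))) -
          sphereTDFlowLogJac hG T s c (fun m => (ω' m : E)))
          ∂Measure.pi (fun _ : Λ => uniformSphere (volume : Measure E))) ^ 2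
        ∂Measure.pi (fun _ : Λ => uniformSphere (volume : Measure E)) ≤
      (∑ k, D k ^ 2) / 4 :=
  variance_le_of_bddDiff (uniformSphere (volume : Measure E)) (continuous_effAction hG hG3 hS t s c)
    hD

/-- **THE LOG-WEIGHTS ARE SUB-GAUSSIAN**: `∫ e^{u(S_eff − E S_eff)} dπ̄ ≤ exp(u²·ΣD_k²/8)` (McDiarmid). -/
theorem integral_exp_mul_effAction_sub_le_of_bddDiff (hG : ContDiff ℝ 2 fun q : ℝ × (Λ → E) => G q.1 q.2)
    (hG3 : ContDiff ℝ 3 fun q : ℝ × (Λ → E) => G q.1 q.2) {S : (Λ → E) → ℝ} (hS : ContDiff ℝ 1 S)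
    (t s c : ℝ) {D : Λ → ℝ}
    (hD : ∀ (ω : Λ → sphere (0 : E) 1) (k : Λ) (v v' : sphere (0 : E) 1),
      (t * S (sphereTDFlow hG T s c (fun m => ((update ω k v) m : E))) -
          sphereTDFlowLogJac hG T s c (fun m => ((update ω k v) m : E))) -
        (t * S (sphereTDFlow hG T s c (fun m => ((update ω k v') m : E))) -
          sphereTDFlowLogJac hG T s c (fun m => ((update ω k v') m : E))) ≤ D k) (u : ℝ) :
    ∫ ω, Real.exp (u * (t * S (sphereTDFlow hG T s c (fun m => ((ω : Λ → sphere (0 : E) 1) m : E))) -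
          sphereTDFlowLogJac hG T s c (fun m => (ω m : E)) -
        ∫ ω', (t * S (sphereTDFlow hG T s c (fun m => ((ω' : Λ → sphere (0 : E) 1) m : E))) -
          sphereTDFlowLogJac hG T s c (fun m => (ω' m : E)))
          ∂Measure.pi (fun _ : Λ => uniformSphere (volume : Measure E))))
        ∂Measure.pi (fun _ : Λ => uniformSphere (volume : Measure E)) ≤
      Real.exp (u ^ 2 * (∑ k, D k ^ 2) / 8) :=
  mcdiarmid_integral_exp_le (uniformSphere (volume : Measure E)) (continuous_effAction hG hG3 hS t s c) hD u

/-- **THE VOLUME LAW FOR THE RELATIVE ENTROPY**: `KL((Φ_{s→c})_*π̄ ‖ π̄.tilted(−tS)) ≤ ΣD_k²/8` for every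
exact flow sampler whose effective action has bounded differences `D_k` (`|s|, |c| ≤ |T| + 1`). -/
theorem toReal_klDiv_map_le_of_bddDiff (hG : ContDiff ℝ 2 fun q : ℝ × (Λ → E) => G q.1 q.2)
    (hG3 : ContDiff ℝ 3 fun q : ℝ × (Λ → E) => G q.1 q.2) {S : (Λ → E) → ℝ} (hS : ContDiff ℝ 1 S)
    (t : ℝ) {s c : ℝ} (hs : |s| ≤ |T| + 1) (hc : |c| ≤ |T| + 1) {D : Λ → ℝ}
    (hD : ∀ (ω : Λ → sphere (0 : E) 1) (k : Λ) (v v' : sphere (0 : E) 1),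
      (t * S (sphereTDFlow hG T s c (fun m => ((update ω k v) m : E))) -
          sphereTDFlowLogJac hG T s c (fun m => ((update ω k v) m : E))) -
        (t * S (sphereTDFlow hG T s c (fun m => ((update ω k v') m : E))) -
          sphereTDFlowLogJac hG T s c (fun m => ((update ω k v') m : E))) ≤ D k) :
    (klDiv (Measure.map (sphereTDFlowMap hG T s c)
          (Measure.pi (fun _ : Λ => uniformSphere (volume : Measure E))))
        ((Measure.pi (fun _ : Λ => uniformSphere (volume : Measure E))).tilted
          fun ω => -(t * S (fun m => (ω m : E))))).toReal ≤ (∑ k, D k ^ 2) / 8 := by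
  rw [toReal_klDiv_map_sphereTDFlowMap_tilted hG hG3 hS t hs hc]
  set μ : Measure (Λ → sphere (0 : E) 1) := Measure.pi (fun _ : Λ => uniformSphere (volume : Measure E))
    with hμ
  set F : (Λ → sphere (0 : E) 1) → ℝ := fun ω =>
    t * S (sphereTDFlow hG T s c (fun m => (ω m : E))) - sphereTDFlowLogJac hG T s c (fun m => (ω m : E))
    with hF
  set A : ℝ := ∑ k, D k ^ 2 with hA
  set m : ℝ := ∫ ω, F ω ∂μ with hm
  -- the partition function is `∫ e^{−S_eff} dπ̄` (exact reweighting with `H = 1`)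
  have hZ : ∫ ω, Real.exp (-(t * S (fun m => ((ω : Λ → sphere (0 : E) 1) m : E)))) ∂μ =
      ∫ ω, Real.exp (-F ω) ∂μ := by
    have hw := integral_exp_sphereTDFlowLogJac_sub_mul_comp hG hG3 hS (contDiff_const (c := (1 : ℝ)))
      t hs hc (T := T)
    simp only [mul_one] at hw
    rw [hμ, ← hw]
    refine integral_congr_ae (ae_of_all _ fun ω => ?_)
    simp only [hF, neg_sub]
  -- McDiarmid at `u = −1`
  have hMc := integral_exp_mul_effAction_sub_le_of_bddDiff hG hG3 hS t s c hD (-1)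
  rw [← hμ] at hMc
  have hexp : ∫ ω, Real.exp (-F ω) ∂μ ≤ Real.exp (-m) * Real.exp (A / 8) := by
    have e : ∀ ω, Real.exp (-F ω) = Real.exp (-m) * Real.exp (-1 * (F ω - m)) := by
      intro ω; rw [← Real.exp_add]; congr 1; ring
    simp_rw [e]
    rw [integral_const_mul]
    refine mul_le_mul_of_nonneg_left (hMc.trans (le_of_eq ?_)) (Real.exp_pos _).le
    congr 1; rw [hA]; ring
  have hZpos : 0 < ∫ ω, Real.exp (-F ω) ∂μ := by
    rw [← hZ, hμ]
    exact integral_exp_neg_mul_pos (Λ := Λ) hS.continuous t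
  rw [hZ]
  have hlog : Real.log (∫ ω, Real.exp (-F ω) ∂μ) ≤ -m + A / 8 := by
    rw [Real.log_le_iff_le_exp hZpos, Real.exp_add]
    exact hexp
  have hgoal : m + Real.log (∫ ω, Real.exp (-F ω) ∂μ) ≤ A / 8 := by linarith
  simpa [hm, hA] using hgoal

/-- **THE VOLUME LAW FOR THE EFFECTIVE SAMPLE SIZE**: `exp(−ΣD_k²/2)·∫ w² dπ̄ ≤ (∫ w dπ̄)²` for the
importance weights `w = exp(ℓ_{s→c} − t·S∘Φ_{s→c}) = e^{−S_eff}` of any exact flow sampler whose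
effective action has bounded differences `D_k`: the effective-sample-size fraction is at least
`exp(−ΣD_k²/2)` — the reweighting cost in nats is at most half the sum of the squared differences. -/
theorem sq_integral_weight_ge_of_bddDiff (hG : ContDiff ℝ 2 fun q : ℝ × (Λ → E) => G q.1 q.2)
    (hG3 : ContDiff ℝ 3 fun q : ℝ × (Λ → E) => G q.1 q.2) {S : (Λ → E) → ℝ} (hS : ContDiff ℝ 1 S)
    (t s c : ℝ) {D : Λ → ℝ}
    (hD : ∀ (ω : Λ → sphere (0 : E) 1) (k : Λ) (v v' : sphere (0 : E) 1),
      (t * S (sphereTDFlow hG T s c (fun m => ((update ω k v) m : E))) -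
          sphereTDFlowLogJac hG T s c (fun m => ((update ω k v) m : E))) -
        (t * S (sphereTDFlow hG T s c (fun m => ((update ω k v') m : E))) -
          sphereTDFlowLogJac hG T s c (fun m => ((update ω k v') m : E))) ≤ D k) :
    Real.exp (-((∑ k, D k ^ 2) / 2)) *
        ∫ ω, Real.exp (sphereTDFlowLogJac hG T s c (fun m => ((ω : Λ → sphere (0 : E) 1) m : E)) -
          t * S (sphereTDFlow hG T s c (fun m => (ω m : E)))) ^ 2
          ∂Measure.pi (fun _ : Λ => uniformSphere (volume : Measure E)) ≤
      (∫ ω, Real.exp (sphereTDFlowLogJac hG T s c (fun m => ((ω : Λ → sphere (0 : E) 1) m : E)) -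
          t * S (sphereTDFlow hG T s c (fun m => (ω m : E))))
          ∂Measure.pi (fun _ : Λ => uniformSphere (volume : Measure E))) ^ 2 := by
  set μ : Measure (Λ → sphere (0 : E) 1) := Measure.pi (fun _ : Λ => uniformSphere (volume : Measure E))
    with hμ
  set F : (Λ → sphere (0 : E) 1) → ℝ := fun ω =>
    t * S (sphereTDFlow hG T s c (fun m => (ω m : E))) - sphereTDFlowLogJac hG T s c (fun m => (ω m : E))
    with hF
  set A : ℝ := ∑ k, D k ^ 2 with hA
  set m : ℝ := ∫ ω, F ω ∂μ with hm
  have hFc : Continuous F := continuous_effAction hG hG3 hS t s c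
  have hFi : Integrable F μ := integrable_pi_of_continuous _ hFc
  have hw : ∀ ω : Λ → sphere (0 : E) 1,
      Real.exp (sphereTDFlowLogJac hG T s c (fun m => (ω m : E)) -
        t * S (sphereTDFlow hG T s c (fun m => (ω m : E)))) = Real.exp (-F ω) := by
    intro ω; simp only [hF, neg_sub]
  simp_rw [hw]
  -- lower bound on `∫ e^{−F}`: `≥ e^{−m}`
  have hlow : Real.exp (-m) ≤ ∫ ω, Real.exp (-F ω) ∂μ := by
    have e : ∀ ω, Real.exp (-F ω) = Real.exp (-m) * Real.exp (-(F ω - m)) := by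
      intro ω; rw [← Real.exp_add]; congr 1; ring
    simp_rw [e]
    rw [integral_const_mul]
    have hi : Integrable (fun ω => F ω - m) μ := hFi.sub (integrable_const m)
    have hi1 : Integrable (fun ω => 1 - (F ω - m)) μ := (integrable_const (1 : ℝ)).sub hi
    have h1 : ∫ ω, (1 - (F ω - m)) ∂μ ≤ ∫ ω, Real.exp (-(F ω - m)) ∂μ := by
      refine integral_mono hi1
        (integrable_pi_of_continuous _ (Real.continuous_exp.comp (hFc.sub continuous_const).neg))
        fun ω => ?_
      have h := Real.add_one_le_exp (-(F ω - m))
      simp only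
      linarith
    have hint1 : ∫ _ω, (1 : ℝ) ∂μ = 1 := by
      simp only [integral_const, smul_eq_mul, hμ, probReal_univ, one_mul]
    have hintF : ∫ ω, (F ω - m) ∂μ = 0 := by
      rw [integral_sub hFi (integrable_const m), integral_const, smul_eq_mul, hμ, probReal_univ,
        one_mul, ← hμ, ← hm, sub_self]
    have h2 : ∫ ω, (1 - (F ω - m)) ∂μ = 1 := by
      rw [integral_sub (integrable_const (1 : ℝ)) hi, hint1, hintF, sub_zero]
    rw [h2] at h1
    calc Real.exp (-m) = Real.exp (-m) * 1 := (mul_one _).symm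
      _ ≤ Real.exp (-m) * ∫ ω, Real.exp (-(F ω - m)) ∂μ :=
          mul_le_mul_of_nonneg_left h1 (Real.exp_pos _).le
  -- upper bound on `∫ e^{−2F}` by McDiarmid at `u = −2`
  have hMc := integral_exp_mul_effAction_sub_le_of_bddDiff hG hG3 hS t s c hD (-2)
  rw [← hμ] at hMc
  have hup : ∫ ω, Real.exp (-F ω) ^ 2 ∂μ ≤ Real.exp (-(2 * m)) * Real.exp (A / 2) := by
    have e : ∀ ω, Real.exp (-F ω) ^ 2 = Real.exp (-(2 * m)) * Real.exp (-2 * (F ω - m)) := by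
      intro ω; rw [sq, ← Real.exp_add, ← Real.exp_add]; congr 1; ring
    simp_rw [e]
    rw [integral_const_mul]
    refine mul_le_mul_of_nonneg_left (hMc.trans (le_of_eq ?_)) (Real.exp_pos _).le
    congr 1; rw [hA]; ring
  have hIpos : 0 ≤ ∫ ω, Real.exp (-F ω) ∂μ := le_trans (Real.exp_pos _).le hlow
  calc Real.exp (-(A / 2)) * ∫ ω, Real.exp (-F ω) ^ 2 ∂μ
      ≤ Real.exp (-(A / 2)) * (Real.exp (-(2 * m)) * Real.exp (A / 2)) :=
        mul_le_mul_of_nonneg_left hup (Real.exp_pos _).le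
    _ = Real.exp (-m) * Real.exp (-m) := by
        rw [← Real.exp_add, ← Real.exp_add, ← Real.exp_add]; congr 1; ring
    _ ≤ (∫ ω, Real.exp (-F ω) ∂μ) * ∫ ω, Real.exp (-F ω) ∂μ :=
        mul_le_mul hlow hlow (Real.exp_pos _).le hIpos
    _ = (∫ ω, Real.exp (-F ω) ∂μ) ^ 2 := by ring

end Summit.Ventures.LatticeQCDFlow.Exactness

end
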